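import Summits.BirchSwinnertonDyer.BirchSwinnertonDyer.Theorems.PrintX10bReadoutIndexOfLocalClauses
import Literature.NumberTheory.EllipticCurves.ZpExtensionEisensteinTwistLocalH1UniformCardProofs
import Literature.NumberTheory.EllipticCurves.AnticyclotomicHeegnerPlacesDecompositionProofs
import HarnessLib

/-!
# Letter (B5-BAD) `Stmt.readoutLocalIndexBad` of `stub_readoutIndex` PROVED (with `Fv := ⊤`): the local index of Howard's
# propagated condition at the places `v ∣ N`, `v ∤ p` is `≤ p^{8p^e}`, uniformly in `m`, the tower level and the datum
# (helper for the shared μ-crux `MuInequalityCoherentPairOfPrintCG`, stmt-BirchSwinnertonDyer-23428; cell `pub/bsd-print-x9`,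
# seat `bsd-line-x10b-p2` g8, S1-DISCRETE lane)

Summits-side helper, THEOREMS ONLY (no definition, no named fact, no instance, no `sorry`); ROUTE-INDEPENDENT (no `Theses`
import).  It discharges the third place-wise clause of `HeegnerMuPartControlGlue.readoutIndex_of_localClauses`
(x10b-p1-w2 g11, `Theorems/PrintX10bReadoutIndexOfLocalClauses`):
**`HeegnerMuPartControlGlue.stub_readoutLocalIndexBad : Stmt.readoutLocalIndexBad`** — at every `v ∈ S` with `v ∤ p` (so
`v ∣ N` by `_hSN`) take the relaxed condition `Fv := ⊤` (its first clause is then vacuous) and bound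
`#(⊤ ⧸ condA F j v) ≤ #H¹(K_v, T^{(j)}) ≤ p^{8 p^e}` by this seat's `WeierstrassCurve.finite_and_natCard_top_quotient_le_pow_eisensteinTower`
(`Literature/…/ZpExtensionEisensteinTwistLocalH1UniformCardProofs`, over x9-p1-w4's `m`-uniform local Euler-characteristic count
`#H¹(K_v, E[p^j] ⊗ A_{m,j}(ψ)) ≤ p^{8N}`), where `p^e` is ONE exact value of `κ⁻¹ = κ.unitTwist (-1)` on the decomposition groups
of ALL places `v ∣ N`, `v ∤ p` (`ZpExtension.exists_forall_toAdd_apply_absGaloisRestrict_eq_pow_of_natCast_mem`; these places are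
finitely decomposed in the anticyclotomic `K_∞` by the Heegner hypothesis and Brink,
`decomp_not_le_kerSubgroup_of_natCast_mem_of_satisfiesHeegnerHypothesis`).  Constants: `c := 8 p^e`, `m₁ := 2 p^e + 1`, `j₀ := 0`
— chosen before `m` and before the datum, as the letter demands.
HONEST FRAMING: this is the `v ∈ Σ ∖ {v ∣ p}` clause of Howard's Lemma 2.2.7 at `𝔮 = T^m + p` with the honest `m`-uniform
count replacing «depending only on `[S_𝔮 : Λ/𝔮]`»; (B5-OFF) and (B5-P) are other seats' clauses; «beyond-print theorem»: no.
BSD is not proved by any of this; no summit statement is proved by this seat.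

References: [Howard2004HeegnerKolyvagin] Lemma 2.2.7 / Prop. 2.2.8, proof of Thm. 2.2.10 (arXiv:1202.6340 p. 16 L142–152,
p. 17 L41–53, p. 18 L16–17); [MilneADT2006] I Thm. 2.8; [Brink2007] Thm. 2, Cor. 1; [GreenbergLNM1716] §4 p. 98.
-/

set_option linter.dupNamespace false
set_option autoImplicit false

noncomputable section

open scoped Classical Pointwise ContRepresentation TensorProduct NumberField

open Function NumberField IsDedekindDomain Field
open Literature Literature.NumberTheory.EllipticCurves WeierstrassCurve
open Literature.NumberTheory.GaloisCohomology Literature.NumberTheory.GaloisCohomology.Howard2004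
open Literature.NumberTheory.GaloisRepresentations Literature.NumberTheory.GaloisRepresentations.DiscreteGaloisModule
open Literature.NumberTheory.EllipticCurves.GreenbergSelmer
open Summit.BirchSwinnertonDyer.BirchSwinnertonDyer.Theorems

namespace Summit.BirchSwinnertonDyer.BirchSwinnertonDyer.Theorems.HeegnerMuPartControlGlue

set_option maxHeartbeats 400000 in
set_option synthInstance.maxHeartbeats 80000 in
/-- **Letter (B5-BAD) `Stmt.readoutLocalIndexBad` holds, with `Fv := ⊤`**: `c := 8 p^e`, `m₁ := 2 p^e + 1`, `j₀ := 0`, `p^e` one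
exact value of `κ⁻¹` on `Γ_{K_v}` for all `v ∣ N`, `v ∤ p` (finitely decomposed in `K_∞` by (Heeg) + Brink); the index bound is
`#(⊤ ⧸ condA F j v) ≤ #H¹(K_v, T^{(j)}) ≤ p^{8 p^e}` (prime-to-`p` local Euler characteristic, uniform in `m` and `j`).
[cite: Howard2004HeegnerKolyvagin, Lemma 2.2.7 / Prop. 2.2.8 and proof of Thm. 2.2.10 (𝔮 = T^m + p)] [cite: MilneADT2006, I Thm. 2.8]
[cite: Brink2007, Thm. 2 and Cor. 1] -/
theorem stub_readoutLocalIndexBad : Stmt.readoutLocalIndexBad := by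
  intro hCG N _ W _ K _ _ p _ κ γ jbar hyp _hCM _hirr _hirrK _hsc _hHp _hhK
  haveI := hyp.isElliptic
  have hN0 : N ≠ 0 := NeZero.ne N
  -- one exponent `e` for `κ⁻¹ = κ.unitTwist (-1)` over the places above `N` away from `p`
  have hdec : ∀ v : HeightOneSpectrum (𝓞 K), ((N : ℕ) : 𝓞 K) ∈ v.asIdeal → ((p : ℕ) : 𝓞 K) ∉ v.asIdeal →
      ¬ (GreenbergSelmer.decomp v ≤ κ.kerSubgroup) := fun v hNv hpv ↦
    ZpExtension.decomp_not_le_kerSubgroup_of_natCast_mem_of_satisfiesHeegnerHypothesis hyp.isImaginaryQuadratic κ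
      hyp.anticyclotomic hyp.heegner hN0 v hpv hNv
  obtain ⟨e, he⟩ := ZpExtension.exists_forall_toAdd_apply_absGaloisRestrict_eq_pow_of_natCast_mem κ hN0 hdec
  refine ⟨8 * p ^ e, 2 * p ^ e + 1, fun m hm hm₁ ↦ ?_⟩
  letI := IwasawaAlgebra.isDomain_quotient_X_pow_add_C p hm
  letI := IwasawaAlgebra.isDiscreteValuationRing_quotient_X_pow_add_C p hm
  haveI := IwasawaAlgebra.EisensteinCoeff.isLocalRing_succ p hm
  letI := IwasawaAlgebra.EisensteinCoeff.algebraOfSpecSucc p m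
  haveI := W.isScalarTower_algebraOfSpecSucc (K := K) (p := p) (m := m)
  letI := W.residueModuleSucc (K := K) (p := p) hm
  intro S hpS hbad hSN hSσ L hL hLS jbar' cd Dd fs hy hπ he' hπX hek
  refine ⟨0, fun j _ v hvS hpv ↦ ?_⟩
  obtain ⟨h, hh⟩ := he v ((hSN v hvS).resolve_left hpv) hpv
  have hh' : ((κ.unitTwist (-1)) (absGaloisRestrict K (v.adicCompletion K) h⁻¹)).toAdd = ((p ^ e : ℕ) : ℤ_[p]) := by
    rw [ZpExtension.unitTwist_apply, toAdd_ofAdd, map_inv, map_inv, toAdd_inv, hh, Units.val_neg, Units.val_one,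
      neg_one_mul, neg_neg]
  refine ⟨⊤, fun c _ ↦ AddSubgroup.mem_top _, ?_⟩
  exact W.finite_and_natCard_top_quotient_le_pow_eisensteinTower κ hm v hpv h⁻¹ (Nat.one_le_pow _ _ (Fact.out : p.Prime).pos)
    hh' (by omega) j _

end Summit.BirchSwinnertonDyer.BirchSwinnertonDyer.Theorems.HeegnerMuPartControlGlue

end
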